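import Summits.Langlands.Langlands.Statement
import Summits.Langlands.Langlands.Theorems.IrreducibilityBySelfDualityReciprocityUpToIrreducibilityCorrespondsConj
import HarnessLib

/-!
# The piece-level compositions of line `pieces` as importable theorems
# (crux `ReciprocityTRCM`, stmt-Langlands-1093; `--supports` helper)

Support file (closes nothing).  Three sorry-free compositions of the registered skeleton
`Cruxes/ReciprocityTRCM/Lines/pieces.lean` (strategist decomposition X₁/X₂/X₃, kernel-checked there since
cycle 1) are made IMPORTABLE here, with every hypothesis and conclusion written out VERBATIM as the ledger
item it is (no route import, no `def`):

* `reciprocityCMtoTR_of_autToGalCMtoTR_of_weak` — item stmt-Langlands-1096 `ReciprocityCMtoTR`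
  (reciprocity over CM ⇒ over totally real; shared by routes BaseFieldAscent, CMFern, SmithKummerSeed) from
  item stmt-Langlands-1063 `AutToGalCMtoTR` ((A) CM ⇒ TR, Sorensen patching) and the WEAK direction (B)
  over totally real fields given reciprocity over CM (the conclusion of `weakGalToAutTR_of_reciprocityCM`,
  sibling file `…WeakGalToAutTROfCM`).  NOT a one-line seam: weak (B) (a.e. Satake–Frobenius compatibility)
  is UPGRADED to (B) with local–global compatibility at every finite place by the landed Chebotarev +
  Brauer–Nesbitt transport `ReciprocityUpToIrreducibility.corresponds_of_exists_corresponds` ((A) gives SOME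
  `ρ'` corresponding to `π`; two irreducible avatars of one `π` are conjugate; `Corresponds` descends to
  conjugacy classes).
* `weakGalToAutCM_of_potentialAutomorphyCM_of_descent` — piece `X₂ = WeakGalToAutCM` (weak (B) over CM
  fields for every datum carrying (A)) from potential weak automorphy over CM fields (stub
  `stub_potentialAutomorphyCM`) and descent of weak automorphy (item stmt-Langlands-1062, verbatim).
* `reciprocityTRCM_of_autToGalCM_of_weakGalToAutCM_of_reciprocityCMtoTR` — the crux statement
  (item stmt-Langlands-1093, verbatim) from `X₁` = item stmt-Langlands-1059, `X₂`, and `X₃` = item 1096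
  (same weak-to-strong upgrade over CM fields; case split TR/CM).

Standard axioms; no definitions.

## References
* P. Deligne, J.-P. Serre, *Formes modulaires de poids 1*, ASENS 7 (1974), Lemme 3.2 (Chebotarev +
  Brauer–Nesbitt). [DeligneSerreASENS1974]
* C. Sorensen, *A patching lemma*, (2020), Thm. 1. [Sorensen2020]
-/

noncomputable section

set_option linter.dupNamespace false -- project-wide option (lakefile weak.linter.dupNamespace); `Summit.Langlands.Langlands` is the mandated namespace

open scoped MatrixGroups NumberField
open NumberField IsDedekindDomain Filter
open Literature.NumberTheory.Automorphic Literature.NumberTheory.GaloisRepresentations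
open Summit.Langlands

namespace Summit.Langlands.Langlands.Theorems.ReciprocityTRCM

/-- **Item stmt-Langlands-1096 from item stmt-Langlands-1063 and weak (B) over totally real fields**: over a
totally real `F`, take `𝓡` and (A) from the (A)-transfer CM ⇒ TR, weak (B) for that `𝓡` from the second
hypothesis, and upgrade weak (B) to (B) with local–global compatibility at every finite place by
`corresponds_of_exists_corresponds`. [cite: DeligneSerreASENS1974, Lemme 3.2] [cite: Sorensen2020, Thm. 1] -/
theorem reciprocityCMtoTR_of_autToGalCMtoTR_of_weak
    (h₄ : (∀ (F : Type) [Field F] [NumberField F], NumberField.IsCMField F → ∃ R : ReciprocityData F, ∀ n : ℕ, 0 < n → ∀ hcpt : Literature.NumberTheory.Automorphic.isCompact_glFiniteIntegralLevel n F, AutomorphicToGalois n R hcpt) → ∀ (F : Type) [Field F] [NumberField F], NumberField.IsTotallyReal F → ∃ R : ReciprocityData F, ∀ n : ℕ, 0 < n → ∀ hcpt : Literature.NumberTheory.Automorphic.isCompact_glFiniteIntegralLevel n F, AutomorphicToGalois n R hcpt)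
    (h₅ : (∀ (F : Type) [Field F] [NumberField F], NumberField.IsCMField F → ∃ R : ReciprocityData F, ∀ n : ℕ, 0 < n → ∀ hcpt : Literature.NumberTheory.Automorphic.isCompact_glFiniteIntegralLevel n F, GlobalLanglandsCorrespondenceGLn n F R hcpt) → ∀ (F : Type) [Field F] [NumberField F], NumberField.IsTotallyReal F → ∀ R : ReciprocityData F, (∀ n : ℕ, 0 < n → ∀ hcpt : Literature.NumberTheory.Automorphic.isCompact_glFiniteIntegralLevel n F, AutomorphicToGalois n R hcpt) → ∀ (n : ℕ), 0 < n → ∀ (ℓ : ℕ) [Fact ℓ.Prime] (ι : PadicAlgCl ℓ ≃+* ℂ) (ρ : Literature.NumberTheory.GaloisRepresentations.FramedGaloisRep F (PadicAlgCl ℓ) n), ρ.toGaloisRep.IsIrreducible → IsGeometricFramed R ρ → ∀ hcpt : Literature.NumberTheory.Automorphic.isCompact_glFiniteIntegralLevel n F, ∃ π : Literature.NumberTheory.Automorphic.CuspidalAutomorphicRepData n F hcpt, π.1.IsLAlgebraic ∧ ∀ᶠ v : IsDedekindDomain.HeightOneSpectrum (NumberField.RingOfIntegers F) in cofinite, SatakeFrobCompatibleAt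 ι π.1 ρ v) :
    (∀ (F : Type) [Field F] [NumberField F], NumberField.IsCMField F → ∃ R : ReciprocityData F, ∀ n : ℕ, 0 < n → ∀ hcpt : Literature.NumberTheory.Automorphic.isCompact_glFiniteIntegralLevel n F, GlobalLanglandsCorrespondenceGLn n F R hcpt) → ∀ (F : Type) [Field F] [NumberField F], NumberField.IsTotallyReal F → ∃ R : ReciprocityData F, ∀ n : ℕ, 0 < n → ∀ hcpt : Literature.NumberTheory.Automorphic.isCompact_glFiniteIntegralLevel n F, GlobalLanglandsCorrespondenceGLn n F R hcpt := by
  intro hCM F _ _ hTR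
  -- (A) over CM fields, extracted from reciprocity over CM fields
  have hAcm : ∀ (F : Type) [Field F] [NumberField F], NumberField.IsCMField F →
      ∃ R : ReciprocityData F, ∀ n : ℕ, 0 < n →
        ∀ hcpt : Literature.NumberTheory.Automorphic.isCompact_glFiniteIntegralLevel n F,
          AutomorphicToGalois n R hcpt := by
    intro E _ _ hE
    obtain ⟨R, hR⟩ := hCM E hE
    exact ⟨R, fun n hn hcpt => (hR n hn hcpt).1⟩
  obtain ⟨R, hA⟩ := h₄ hAcm F hTR
  refine ⟨R, fun n hn hcpt => ⟨hA n hn hcpt, ?_⟩⟩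
  intro ℓ _ ι ρ hirr hgeo
  obtain ⟨π, hL, hsat⟩ := h₅ hCM F hTR R hA n hn ℓ ι ρ hirr hgeo hcpt
  obtain ⟨ρ', -, -, hcorr', -⟩ := hA n hn hcpt π hL ℓ ι
  exact ⟨π, hL,
    ReciprocityUpToIrreducibility.corresponds_of_exists_corresponds hirr hsat ⟨ρ', hcorr'⟩⟩

/-- **Piece `X₂ = WeakGalToAutCM` from potential weak automorphy over CM fields and descent of weak
automorphy** (item stmt-Langlands-1062, verbatim): modus ponens. [folklore] -/
theorem weakGalToAutCM_of_potentialAutomorphyCM_of_descent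
    (h₂ : ∀ (F : Type) [Field F] [NumberField F], NumberField.IsCMField F → ∀ R : ReciprocityData F, (∀ n : ℕ, 0 < n → ∀ hcpt : Literature.NumberTheory.Automorphic.isCompact_glFiniteIntegralLevel n F, AutomorphicToGalois n R hcpt) → ∀ (n : ℕ), 0 < n → ∀ (ℓ : ℕ) [Fact ℓ.Prime] (ι : PadicAlgCl ℓ ≃+* ℂ) (ρ : Literature.NumberTheory.GaloisRepresentations.FramedGaloisRep F (PadicAlgCl ℓ) n), ρ.toGaloisRep.IsIrreducible → IsGeometricFramed R ρ → ∃ (F' : Type) (_ : Field F') (_ : NumberField F') (_ : Algebra F F') (_ : IsGalois F F'), (ρ.restrictField F').toGaloisRep.IsIrreducible ∧ ∃ (hcpt' : Literature.NumberTheory.Automorphic.isCompact_glFiniteIntegralLevel n F') (π' : Literature.NumberTheory.Automorphic.CuspidalAutomorphicRepData n F' hcpt'), π'.1.IsLAlgebraic ∧ ∀ᶠ w : IsDedekindDomain.HeightOneSpectrum (NumberField.RingOfIntegers F') in cofinite, SatakeFrobCompatibleAt ι π'.1 (ρ.restrictField F') w)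
    (h₃ : ∀ (F : Type) [Field F] [NumberField F] (R : ReciprocityData F), (∀ n : ℕ, 0 < n → ∀ hcpt : Literature.NumberTheory.Automorphic.isCompact_glFiniteIntegralLevel n F, AutomorphicToGalois n R hcpt) → ∀ (n : ℕ), 0 < n → ∀ (ℓ : ℕ) [Fact ℓ.Prime] (ι : PadicAlgCl ℓ ≃+* ℂ) (ρ : Literature.NumberTheory.GaloisRepresentations.FramedGaloisRep F (PadicAlgCl ℓ) n), ρ.toGaloisRep.IsIrreducible → IsGeometricFramed R ρ → (∃ (F' : Type) (_ : Field F') (_ : NumberField F') (_ : Algebra F F') (_ : IsGalois F F'), (ρ.restrictField F').toGaloisRep.IsIrreducible ∧ ∃ (hcpt' : Literature.NumberTheory.Automorphic.isCompact_glFiniteIntegralLevel n F') (π' : Literature.NumberTheory.Automorphic.CuspidalAutomorphicRepData n F' hcpt'), π'.1.IsLAlgebraic ∧ ∀ᶠ w : IsDedekindDomain.HeightOneSpectrum (NumberField.RingOfIntegers F') in cofinite, SatakeFrobCompatibleAt ι π'.1 (ρ.restrictField F') w) → ∀ hcpt : Literature.NumberTheory.Automorphic.isCompact_glFiniteIntegralLevel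 n F, ∃ π : Literature.NumberTheory.Automorphic.CuspidalAutomorphicRepData n F hcpt, π.1.IsLAlgebraic ∧ ∀ᶠ v : IsDedekindDomain.HeightOneSpectrum (NumberField.RingOfIntegers F) in cofinite, SatakeFrobCompatibleAt ι π.1 ρ v) :
    ∀ (F : Type) [Field F] [NumberField F], NumberField.IsCMField F → ∀ R : ReciprocityData F, (∀ n : ℕ, 0 < n → ∀ hcpt : Literature.NumberTheory.Automorphic.isCompact_glFiniteIntegralLevel n F, AutomorphicToGalois n R hcpt) → ∀ (n : ℕ), 0 < n → ∀ (ℓ : ℕ) [Fact ℓ.Prime] (ι : PadicAlgCl ℓ ≃+* ℂ) (ρ : Literature.NumberTheory.GaloisRepresentations.FramedGaloisRep F (PadicAlgCl ℓ) n), ρ.toGaloisRep.IsIrreducible → IsGeometricFramed R ρ → ∀ hcpt : Literature.NumberTheory.Automorphic.isCompact_glFiniteIntegralLevel n F, ∃ π : Literature.NumberTheory.Automorphic.CuspidalAutomorphicRepData n F hcpt, π.1.IsLAlgebraic ∧ ∀ᶠ v : IsDedekindDomain.HeightOneSpectrum (NumberField.RingOfIntegers F) in cofinite, SatakeFrobCompatibleAt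 ι π.1 ρ v := by
  intro F _ _ hF R hA n hn ℓ _ ι ρ hirr hgeo hcpt
  exact h₃ F R hA n hn ℓ ι ρ hirr hgeo (h₂ F hF R hA n hn ℓ ι ρ hirr hgeo) hcpt

/-- **The crux statement (item stmt-Langlands-1093, verbatim) from `X₁` (item stmt-Langlands-1059), `X₂`
and `X₃` (item stmt-Langlands-1096)**: over CM fields `𝓡` and (A) come from `X₁`, weak (B) for that `𝓡`
from `X₂`, upgraded to (B) by `corresponds_of_exists_corresponds`; totally real fields are `X₃` applied to
the CM statement. [cite: DeligneSerreASENS1974, Lemme 3.2] -/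
theorem reciprocityTRCM_of_autToGalCM_of_weakGalToAutCM_of_reciprocityCMtoTR
    (h₁ : ∀ (F : Type) [Field F] [NumberField F], NumberField.IsCMField F → ∃ R : ReciprocityData F, ∀ n : ℕ, 0 < n → ∀ hcpt : Literature.NumberTheory.Automorphic.isCompact_glFiniteIntegralLevel n F, AutomorphicToGalois n R hcpt)
    (h₂ : ∀ (F : Type) [Field F] [NumberField F], NumberField.IsCMField F → ∀ R : ReciprocityData F, (∀ n : ℕ, 0 < n → ∀ hcpt : Literature.NumberTheory.Automorphic.isCompact_glFiniteIntegralLevel n F, AutomorphicToGalois n R hcpt) → ∀ (n : ℕ), 0 < n → ∀ (ℓ : ℕ) [Fact ℓ.Prime] (ι : PadicAlgCl ℓ ≃+* ℂ) (ρ : Literature.NumberTheory.GaloisRepresentations.FramedGaloisRep F (PadicAlgCl ℓ) n), ρ.toGaloisRep.IsIrreducible → IsGeometricFramed R ρ → ∀ hcpt : Literature.NumberTheory.Automorphic.isCompact_glFiniteIntegralLevel n F, ∃ π : Literature.NumberTheory.Automorphic.CuspidalAutomorphicRepData n F hcpt, π.1.IsLAlgebraic ∧ ∀ᶠ v : IsDedekindDomain.HeightOneSpectrum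 (NumberField.RingOfIntegers F) in cofinite, SatakeFrobCompatibleAt ι π.1 ρ v)
    (h₃ : (∀ (F : Type) [Field F] [NumberField F], NumberField.IsCMField F → ∃ R : ReciprocityData F, ∀ n : ℕ, 0 < n → ∀ hcpt : Literature.NumberTheory.Automorphic.isCompact_glFiniteIntegralLevel n F, GlobalLanglandsCorrespondenceGLn n F R hcpt) → ∀ (F : Type) [Field F] [NumberField F], NumberField.IsTotallyReal F → ∃ R : ReciprocityData F, ∀ n : ℕ, 0 < n → ∀ hcpt : Literature.NumberTheory.Automorphic.isCompact_glFiniteIntegralLevel n F, GlobalLanglandsCorrespondenceGLn n F R hcpt) :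
    ∀ (F : Type) [Field F] [NumberField F], (NumberField.IsTotallyReal F ∨ NumberField.IsCMField F) → ∃ R : ReciprocityData F, ∀ n : ℕ, 0 < n → ∀ hcpt : Literature.NumberTheory.Automorphic.isCompact_glFiniteIntegralLevel n F, GlobalLanglandsCorrespondenceGLn n F R hcpt := by
  have hCM : ∀ (F : Type) [Field F] [NumberField F], NumberField.IsCMField F →
      ∃ R : ReciprocityData F, ∀ n : ℕ, 0 < n →
        ∀ hcpt : Literature.NumberTheory.Automorphic.isCompact_glFiniteIntegralLevel n F,
          GlobalLanglandsCorrespondenceGLn n F R hcpt := by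
    intro F _ _ hF
    obtain ⟨R, hA⟩ := h₁ F hF
    refine ⟨R, fun n hn hcpt => ⟨hA n hn hcpt, ?_⟩⟩
    intro ℓ _ ι ρ hirr hgeo
    obtain ⟨π, hL, hsat⟩ := h₂ F hF R hA n hn ℓ ι ρ hirr hgeo hcpt
    obtain ⟨ρ', -, -, hcorr', -⟩ := hA n hn hcpt π hL ℓ ι
    exact ⟨π, hL,
      ReciprocityUpToIrreducibility.corresponds_of_exists_corresponds hirr hsat ⟨ρ', hcorr'⟩⟩
  intro F _ _ hF
  rcases hF with hTR | hCMF
  · exact h₃ hCM F hTR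
  · exact hCM F hCMF

end Summit.Langlands.Langlands.Theorems.ReciprocityTRCM

end
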